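import Summits.BirchSwinnertonDyer.BirchSwinnertonDyer.Theorems.CMKolyvaginAtInertTwoCMPrimitiveSupplyAtInertTwoOfKolyvaginConjecture
import HarnessLib

/-!
# Route `ShiftedKolyvaginAtInertTwo` (leaf `WAllCornerFTwo`), support item stmt-BirchSwinnertonDyer-25416
# `ShiftedSupplyAtInertTwoOfFacts`: the HEEGNER SUPPLY on the shifted habitat, BY NAME (cell
# `bsd-print-cf2`, seat ty2 = discharge interface; closer written by ty2 g14, landed by ty2 g15)

HONEST FRAMING. THEOREMS ONLY — no definition, no named fact; the statement is the item's Prop body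
spelled out VERBATIM (the draft route's Theses file is not imported); it is CONDITIONAL on the item's
own antecedent (modularity `exists_isNewformOf`, Hoffstein–Luo twist non-vanishing, Gross–Zagier at
every level). The leaf and the route's cruxes are OPEN; BSD is not proved by any of this.

CONTENT. On the shifted habitat (CM, `2` inert in the CM field, `ρ̄_{E,2}` onto, analytic rank `1`;
NO Tamagawa condition), for every lattice-optimal odd-Manin datum `Dt`: a Heegner field `K`
(imaginary quadratic, odd `d_K ≠ −3`, Heegner hypothesis at the conductor, the two non-square
exclusions `d_K·(−|Δ|)`, `d_K·(−2|Δ|) ∉ ℚ²`), a frame `(β, ι, d₁)` with `y_K` of infinite order, its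
exact `2`-divisibility exponent `M₀` in `E(K[1])`, and a globally minimal CM twin `E^{(d_K)}` of
analytic rank `0`. This is the sibling route's PROVED supply
`Theorems.CMSupply.cmPrimitiveSupplyAtInertTwo_of_kolyvaginConjectureAtTwo` (item 24649, seat
`bsd-line-cmk2-p1` g3) MINUS its Kolyvagin clause (6) and MINUS the binder `Odd W.tamagawaProduct`
(consumed there only inside (6)); steps (1)–(5), (7) are reused by name:
`CMSupply.exists_heegnerField_derivedPoint_one_not_isOfFinAddOrder`,
`KolyvaginFrobeniusTwo.not_isSquare_and_of_cmInert_two_of_heegner`, Darmon 3.6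
(`exists_kolyvaginHeegnerData_one`), Mordell–Weil over `K[1]`
(`exists_pow_smul_eq_and_not_of_not_isOfFinAddOrder`),
`CMSupply.exists_minimal_twin_hasCM_analyticRank_zero`. Its type is EXACTLY that of item 25416, so
the item closes by name (`ledger workitem close stmt-BirchSwinnertonDyer-25416 --as proved --by
Summit.BirchSwinnertonDyer.Rank1Residual.P2.ShiftedSupply.shiftedSupplyAtInertTwo_ofFacts`).
-/

set_option autoImplicit false

noncomputable section

open scoped Classical

namespace Summit.BirchSwinnertonDyer.Rank1Residual.P2.ShiftedSupply

open WeierstrassCurve NumberField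
open Literature.NumberTheory.EllipticCurves Literature.NumberTheory.EllipticCurves.ModularForms
open Literature.NumberTheory.EllipticCurves.Rank1Residual
open Summit.BirchSwinnertonDyer.BirchSwinnertonDyer.Theorems

/-- **The shifted Heegner supply (item 25416 `ShiftedSupplyAtInertTwoOfFacts`, type verbatim).** On
the shifted habitat (CM, `2` inert, `ρ̄_{E,2}` onto, `r_an = 1`; no Tamagawa condition), for every
lattice-optimal odd-Manin datum `Dt`: the Heegner field `K` (odd `d_K ≠ −3`, Heegner hypothesis, the
two non-square exclusions), a frame `(β, ι, d₁)` with `y_K` non-torsion, its exact `2`-divisibility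
exponent `M₀`, and a globally minimal CM twin of analytic rank `0` — relative to modularity,
Hoffstein–Luo and Gross–Zagier. [cite: HoffsteinLuo1997, Theorem (§1)]
[cite: GrossZagier1986, Thm. I.6.3 with V.§2] [cite: BCDTJAMS2001, Theorem A]
[cite: Darmon2004, Thm. 3.6] -/
theorem shiftedSupplyAtInertTwo_ofFacts :
    (Literature.NumberTheory.EllipticCurves.ModularForms.exists_isNewformOf ∧ Literature.NumberTheory.EllipticCurves.HoffsteinLuo1997_exists_twist_L_one_ne_zero ∧ (∀ (N : ℕ) [NeZero N] (W : WeierstrassCurve ℚ) (K : Type) [Field K] [NumberField K], Literature.NumberTheory.EllipticCurves.gross_zagier N W K)) → ∀ (W : WeierstrassCurve ℚ) [W.IsElliptic] [W.IsGloballyMinimal] [NeZero (W.conductorNorm ℤ)], W.HasCM → Literature.NumberTheory.EllipticCurves.Rank1Residual.CMInert W 2 → W.HasSurjectiveModNGaloisRep (2 : ℤ) → W.analyticRank = 1 → ∀ (Dt : Literature.NumberTheory.EllipticCurves.ModularForms.ModularParametrizationData W (W.conductorNorm ℤ)), (∀ z ∈ Dt.L.lattice, ∃ w ∈ Literature.NumberTheory.EllipticCurves.ModularForms.periodLattice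 Dt.f, z = (Dt.c : ℂ) * w) → Odd Dt.c → ∃ (K : Type) (_ : Field K) (_ : NumberField K), Literature.NumberTheory.EllipticCurves.IsImaginaryQuadratic K ∧ Odd (NumberField.discr K) ∧ NumberField.discr K ≠ -3 ∧ Literature.NumberTheory.EllipticCurves.SatisfiesHeegnerHypothesis (W.conductorNorm ℤ) K ∧ ¬ IsSquare ((NumberField.discr K : ℚ) * -|W.Δ|) ∧ ¬ IsSquare ((NumberField.discr K : ℚ) * (-(2 * |W.Δ|))) ∧ ∃ (β : ℤ) (ι : K →+* ℂ) (d₁ : Literature.NumberTheory.EllipticCurves.KolyvaginHeegnerData Dt β ι 1), ¬ IsOfFinAddOrder d₁.derivedPoint ∧ ∃ M₀ : ℕ, (∃ Q : (W.baseChange (Literature.NumberTheory.EllipticCurves.ringClassField K ι 1)).toAffine.Point, ((2 ^ M₀ : ℕ) : ℤ) • Q = d₁.derivedPoint) ∧ (¬ ∃ Q : (W.baseChange (Literature.NumberTheory.EllipticCurves.ringClassField K ι 1)).toAffine.Point, ((2 ^ (M₀ + 1) : ℕ) : ℤ) • Q = d₁.derivedPoint) ∧ ∃ (Wd : WeierstrassCurve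 ℚ) (_ : Wd.IsElliptic) (_ : Wd.IsGloballyMinimal), (∃ C : WeierstrassCurve.VariableChange ℚ, C • W.quadraticTwist (NumberField.discr K : ℚ) = Wd) ∧ Wd.HasCM ∧ Wd.analyticRank = 0 := by
  rintro ⟨hmod, hHL, hGZ⟩ W _ _ _ hCM hin hρ hr Dt _hDt _hc
  -- (1)+(4): the Heegner field and `y_K` of infinite order
  obtain ⟨K, _, _, hK, hodd, h3, hH, hL, hy⟩ :=
    CMSupply.exists_heegnerField_derivedPoint_one_not_isOfFinAddOrder hmod hHL hGZ W hr
  -- (2): the two non-square exclusions are automatic on the habitat (no Tamagawa input)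
  obtain ⟨hsq1, hsq2⟩ :=
    KolyvaginFrobeniusTwo.not_isSquare_and_of_cmInert_two_of_heegner W hCM hin hρ K hK hodd hH
  -- (3): the frame `(β, ι, d₁)`
  obtain ⟨β, hβ⟩ := exists_dvd_sq_sub_discr_holds (W.conductorNorm ℤ) K hK hH
  let ι : K →+* ℂ := Classical.choice inferInstance
  obtain ⟨d₁⟩ := exists_kolyvaginHeegnerData_one
    (phi_heegnerTau_mem_singularModuliField_holds (W.conductorNorm ℤ) W K) hK Dt β ι hβ
  have hy₁ : ¬ IsOfFinAddOrder d₁.derivedPoint := hy Dt β ι d₁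
  -- (5): the exact exponent `M₀` (Mordell–Weil over the number field `K[1]`)
  haveI : NumberField (ringClassField K ι 1) := numberField_ringClassField hK ι one_ne_zero
  haveI : (W.baseChange (ringClassField K ι 1)).IsElliptic := by rw [baseChange]; infer_instance
  haveI : Module.Finite ℤ (W.baseChange (ringClassField K ι 1)).toAffine.Point := by
    convert (W.baseChange (ringClassField K ι 1)).module_finite_point_holds
  obtain ⟨M₀, hdiv, hndiv⟩ := exists_pow_smul_eq_and_not_of_not_isOfFinAddOrder Nat.prime_two hy₁
  -- (7): the twin
  obtain ⟨Wd, _, _, hWd, hcmd, hrd⟩ := CMSupply.exists_minimal_twin_hasCM_analyticRank_zero hmod W hCM K hL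
  exact ⟨K, _, _, hK, hodd, h3, hH, hsq1, hsq2, β, ι, d₁, hy₁, M₀, hdiv, hndiv, Wd, ‹_›, ‹_›, hWd, hcmd,
    hrd⟩

end Summit.BirchSwinnertonDyer.Rank1Residual.P2.ShiftedSupply

end
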